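import Summits.BirchSwinnertonDyer.BirchSwinnertonDyer.Theorems.AlignedTransportAtTwoMainConjectureOfRankZeroBSDAtTwoHalfDescentBaseIndexComplete
import HarnessLib

/-!
# Route `AlignedTransportAtTwo`, crux C2 `MainConjectureOfRankZeroBSDAtTwo` (stmt-BirchSwinnertonDyer-22298):
# THE BASE TERM CARRIES `p^μ`, VIII — THE RANK-`0` TOWER IN HONEST TERMS: «`char X` coprime to every `ω_n`» ⟺ «every `X/ω_nX` is finite» ⟺ «every `#Sel_{p^∞}(E/K_∞)^{Γ_n} > 0`»,
# so the `γ`-free criterion needs no characteristic series in its statement: if all `#Sel_∞^{Γ_n}` are positive then `μ = 0 ⟺ ∃ n, #Sel_∞^{Γ_n} < p^{pⁿ}`; over `ℚ`, if all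
# `#Sel_{p^∞}(E/ℚ_n)·#ker g_n` are positive then `μ = 0 ⟺ ∃ n, #Sel_{p^∞}(E/ℚ_n)·#ker g_n < p^{pⁿ}`

HONEST FRAMING (cell `bsd-f1-sign2`, WIDTH-5 attached prover seat `bsd-line-att-p5` gen 60 on line `birth` of the lead `bsd-line-att-p2`;
`--supports` stmt-BirchSwinnertonDyer-22298, closes nothing; BSD is NOT proved by any of this; the crux C2, its verdict «blocked-on
`Rank1Residual.GreenbergMuConjectureIrreducible`» and every registered stub (P / T / Kμ / LimDoor / MuIneqʳ / PFμ⁺) are untouched). THEOREMS ONLY — no `def`,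
no instance, no named fact, no `sorry`. Route-independent. Sequel of `…BaseIndexComplete` (completeness stated with the displayed binders `char X = (f)`, `f(0) ≠ 0`, `Ψ_m ∤ f`): those
binders are EQUIVALENT to the positivity of all `#(X/ω_nX)` (⟸: `f(0) = 0` or `Ψ_m ∣ f` makes `X/TX` resp. `X/Ψ_mX`, hence `X/ω_{m+1}X`, infinite — gen 55's
`natCard_quotient_smul_top_eq_zero_of_dvd` and file II; ⟹: file IV's `natCard_quotient_omega_pos`), so the criterion can be stated on the numbers alone. SCOPE (honest): in a tower where
some `Sel_{p^∞}(E/K_n)` is infinite (a cyclotomic `L(E,χ,1) = 0`) the `γ`-free door never opens although `μ` may vanish — there gen 57's growth-number door remains the complete one.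

* §1 (module) `natCard_layerQuotient_ne_zero_of_natCard_quotient_omega_succ_ne_zero` (`X/ω_{m+1}X` finite ⟹ `X/Ψ_mX` finite); ★★ `forall_natCard_quotient_omega_pos_iff`
  (`(∀ n, 0 < #(X/ω_nX)) ⟺ f(0) ≠ 0 ∧ ∀ m, Ψ_m ∤ f`); ★★★ `muInvariant_eq_zero_iff_exists_lt_of_forall_pos` (`(∀ n, 0 < #(X/ω_nX)) ⟹ (μ(X) = 0 ⟺ ∃ n, #(X/ω_nX) < p^{pⁿ})`).
* §2 (Selmer, any `K`, `p`, `κ`) ★★★ `mu_eq_zero_iff_exists_natCard_selmerInvariants_lt_of_forall_pos`; with bounded `ker h`: `mu_eq_zero_iff_exists_natCard_selmerLayer_mul_kerG_lt_of_forall_pos`.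
* §3 (`K = ℚ`) ★★★ `mu_eq_zero_iff_exists_natCard_selmerLayer_mul_kerG_lt_of_forall_pos_rat`: for every elliptic `E/ℚ`, prime `p`, `ℤ_p`-extension, torsion datum:
  **`(∀ n, 0 < #Sel_{p^∞}(E/ℚ_n)·#ker g_n) ⟹ (μ(X(E/ℚ_∞)) = 0 ⟺ ∃ n, #Sel_{p^∞}(E/ℚ_n)·#ker g_n(E/ℚ_n) < p^{pⁿ})`**.
Reading for C2 (`p = 2`, seed): «`Ш(W/ℚ_n)[2^∞]` finite, rank `0` and `ker g_n` finite at every layer» ⟹ road (a)'s stub T at `W` ⟺ `∃ n, #Ш(W/ℚ_n)[2^∞]·#ker g_n < 2^{2ⁿ}`.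
Memo `Cruxes/MainConjectureOfRankZeroBSDAtTwo/BASE-TERM-att-p5-g60.md`. Nothing numerical asserted; C2 untouched.

References: R. Greenberg, LNM 1716 (1999), Thm. 1.10, Conj. 1.11, §3, §4 Lemmas 4.2–4.3 [GreenbergLNM1716]; L. Washington, GTM 83, §13.3 Thm. 13.13 [Washington1997].
-/

set_option linter.dupNamespace false
set_option autoImplicit false

noncomputable section

open scoped Classical Polynomial

universe u

namespace Summit.BirchSwinnertonDyer.BirchSwinnertonDyer.Theorems.AlignedTransportAtTwoHalfDescentBaseIndexRankZero

open WeierstrassCurve Literature.NumberTheory.EllipticCurves Literature.NumberTheory.EllipticCurves.IwasawaAlgebra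
  Summit.BirchSwinnertonDyer.Rank1Residual.X1.MuLambda
  Summit.BirchSwinnertonDyer.Rank1Residual.X1.GeneratorBoundMu
  Summit.BirchSwinnertonDyer.Rank1Residual.Iwasawa
  Summit.BirchSwinnertonDyer.BirchSwinnertonDyer.Theorems.DefectPrime
  Summit.BirchSwinnertonDyer.BirchSwinnertonDyer.Theorems.AlignedTransportAtTwoCyclotomicLayerPrime
  Summit.BirchSwinnertonDyer.BirchSwinnertonDyer.Theorems.AlignedTransportAtTwoHalfDescentLayerIndexCertificate
  Summit.BirchSwinnertonDyer.BirchSwinnertonDyer.Theorems.AlignedTransportAtTwoHalfDescentLayerIndexGrowth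
  Summit.BirchSwinnertonDyer.BirchSwinnertonDyer.Theorems.AlignedTransportAtTwoHalfDescentLayerIndexSelmer
  Summit.BirchSwinnertonDyer.BirchSwinnertonDyer.Theorems.AlignedTransportAtTwoHalfDescentLayerIndexGrowthFiniteCompleteTwo
  Summit.BirchSwinnertonDyer.BirchSwinnertonDyer.Theorems.AlignedTransportAtTwoHalfDescentBaseIndex
  Summit.BirchSwinnertonDyer.BirchSwinnertonDyer.Theorems.AlignedTransportAtTwoHalfDescentBaseIndexSelmer
  Summit.BirchSwinnertonDyer.BirchSwinnertonDyer.Theorems.AlignedTransportAtTwoHalfDescentBaseIndexComplete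

/-! ## §1 Module form -/

section Module

variable {p : ℕ} [hp : Fact p.Prime] {M : Type u} [AddCommGroup M] [Module (IwasawaAlgebra p) M]

/-- `X/ω_{m+1}X` finite ⟹ `X/Ψ_mX` finite (`ω_{m+1} = Ψ_m·ω_m`, `#(X/ω_{m+1}X) = #(X/Ψ_mX)·#(Ψ_mX/ω_{m+1}X)`); in `Nat.card` form. [cite: Washington1997, §13.3 (Lemma 13.18)] -/
theorem natCard_layerQuotient_ne_zero_of_natCard_quotient_omega_succ_ne_zero {m : ℕ}
    (h : Nat.card (M ⧸ (Ideal.span {((1 + PowerSeries.X : PowerSeries ℤ_[p]) ^ (p ^ (m + 1)) - 1 : IwasawaAlgebra p)} • ⊤ : Submodule (IwasawaAlgebra p) M)) ≠ 0) :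
    Nat.card (M ⧸ (Ideal.span {(((Polynomial.cyclotomic (p ^ (m + 1)) ℤ_[p]).comp (Polynomial.X + 1) : ℤ_[p][X]) : IwasawaAlgebra p)} • ⊤ : Submodule (IwasawaAlgebra p) M)) ≠ 0 := by
  intro h0
  apply h
  rw [← coe_cyclotomicLayer_mul_omega p m, natCard_quotient_mul_smul_top_eq, h0, zero_mul]

/-- ★★ **THE RANK-`0` TOWER IN TERMS OF THE NUMBERS: `(∀ n, 0 < #(X/ω_nX)) ⟺ f(0) ≠ 0 ∧ ∀ m, Ψ_m ∤ f`** for every f.g. torsion `X` with `char_Λ X = (f)`.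
[cite: Washington1997, §13.3 (Lemma 13.18, Thm. 13.13)] [cite: GreenbergLNM1716, §4 Lemma 4.2] -/
theorem forall_natCard_quotient_omega_pos_iff [Module.Finite (IwasawaAlgebra p) M] (hM : Module.IsTorsion (IwasawaAlgebra p) M) {f : IwasawaAlgebra p}
    (hchar : Literature.NumberTheory.EllipticCurves.Module.charIdeal (IwasawaAlgebra p) M = Ideal.span {f}) :
    (∀ n, 0 < Nat.card (M ⧸ (Ideal.span {((1 + PowerSeries.X : PowerSeries ℤ_[p]) ^ (p ^ n) - 1 : IwasawaAlgebra p)} • ⊤ : Submodule (IwasawaAlgebra p) M))) ↔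
      PowerSeries.constantCoeff f ≠ 0 ∧ ∀ m, ¬ ((((Polynomial.cyclotomic (p ^ (m + 1)) ℤ_[p]).comp (Polynomial.X + 1) : ℤ_[p][X]) : IwasawaAlgebra p) ∣ f) := by
  refine ⟨fun h ↦ ⟨?_, fun m hdvd ↦ ?_⟩, fun ⟨h0, hΨ⟩ n ↦ natCard_quotient_omega_pos hM hchar h0 (fun m _ ↦ hΨ m)⟩
  · have h0 := h 0
    rw [pow_zero, pow_one, add_sub_cancel_left] at h0
    exact (natCard_quotient_X_smul_top_ne_zero_iff hM hchar).mp h0.ne'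
  · have h1 := natCard_layerQuotient_ne_zero_of_natCard_quotient_omega_succ_ne_zero (M := M) (h (m + 1)).ne'
    exact h1 (natCard_quotient_smul_top_eq_zero_of_dvd (cyclotomic_comp_isDistinguishedAt_maximalIdeal p m) (prime_coe_cyclotomic_comp p m) hM hchar hdvd)

/-- ★★★ **If every `X/ω_nX` is finite then `μ(X) = 0 ⟺ ∃ n, #(X/ω_nX) < p^{pⁿ}`** — `X` ANY f.g. torsion `Λ`-module; no characteristic series in the statement.
[cite: Washington1997, §13.3 Thm. 13.13] [cite: GreenbergLNM1716, Conj. 1.11] -/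
theorem muInvariant_eq_zero_iff_exists_lt_of_forall_pos [Module.Finite (IwasawaAlgebra p) M] (hM : Module.IsTorsion (IwasawaAlgebra p) M)
    (hpos : ∀ n, 0 < Nat.card (M ⧸ (Ideal.span {((1 + PowerSeries.X : PowerSeries ℤ_[p]) ^ (p ^ n) - 1 : IwasawaAlgebra p)} • ⊤ : Submodule (IwasawaAlgebra p) M))) :
    muInvariant p M = 0 ↔ ∃ n : ℕ, Nat.card (M ⧸ (Ideal.span {((1 + PowerSeries.X : PowerSeries ℤ_[p]) ^ (p ^ n) - 1 : IwasawaAlgebra p)} • ⊤ : Submodule (IwasawaAlgebra p) M)) < p ^ (p ^ n) := by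
  obtain ⟨f, hf0, hchar⟩ := exists_charGenerator_ne_zero M hM
  obtain ⟨h0, hΨ⟩ := (forall_natCard_quotient_omega_pos_iff hM hchar).mp hpos
  rw [← Summit.BirchSwinnertonDyer.Rank1Residual.X1.MuPart.mu_generator_eq_muInvariant M hM hf0 hchar, mu_eq_zero_iff_exists_natCard_quotient_omega_pos_lt hM hchar h0 hΨ]
  exact ⟨fun ⟨n, _, hlt⟩ ↦ ⟨n, hlt⟩, fun ⟨n, hlt⟩ ↦ ⟨n, hpos n, hlt⟩⟩

end Module

/-! ## §2 Selmer currency -/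

section Selmer

variable {K : Type u} [Field K] [NumberField K] (W : WeierstrassCurve K) {p : ℕ} [hp : Fact p.Prime] (κ : ZpExtension K p)
  {γ : Field.absoluteGaloisGroup K}

/-- ★★★ **If every `Sel_{p^∞}(E/K_∞)^{Γ_n}` is finite then `μ(X(E/K_∞)) = 0 ⟺ ∃ n, #Sel_{p^∞}(E/K_∞)^{Γ_n} < p^{pⁿ}`** (`E/K`, any `ℤ_p`-extension with topological generator `γ`, any dual datum
with `X` f.g. torsion). [cite: GreenbergLNM1716, §1 pp. 60–65, Conj. 1.11] [cite: Washington1997, §13.3 Thm. 13.13] -/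
theorem mu_eq_zero_iff_exists_natCard_selmerInvariants_lt_of_forall_pos (hγ : κ.IsTopGenerator γ) (D : W.SelmerDualData κ γ) [Module.Finite (IwasawaAlgebra p) D.X]
    (hD : D.IsTorsion) (hpos : ∀ n, 0 < Nat.card ↥(W.selmerInfty κ ⊓ W.layerInvariants κ n)) :
    D.mu = 0 ↔ ∃ n : ℕ, Nat.card ↥(W.selmerInfty κ ⊓ W.layerInvariants κ n) < p ^ (p ^ n) := by
  have hpos' : ∀ n, 0 < Nat.card (D.X ⧸ (Ideal.span {((1 + PowerSeries.X : PowerSeries ℤ_[p]) ^ (p ^ n) - 1 : IwasawaAlgebra p)} • ⊤ : Submodule (IwasawaAlgebra p) D.X)) :=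
    fun n ↦ by rw [natCard_layerQuotient_omega_eq_natCard_selmerInvariants W κ hγ D n]; exact hpos n
  change muInvariant p D.X = 0 ↔ _
  rw [muInvariant_eq_zero_iff_exists_lt_of_forall_pos (M := D.X) hD hpos']
  simp only [natCard_layerQuotient_omega_eq_natCard_selmerInvariants W κ hγ D]

/-- ★★★ **If every `#Sel_{p^∞}(E/K_n)·#ker g_n` is positive and `#ker h_n` is bounded, then `μ(X(E/K_∞)) = 0 ⟺ ∃ n, #Sel_{p^∞}(E/K_n)·#ker g_n < p^{pⁿ}`** (`E/K`, any `p`, any `ℤ_p`-extension,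
any dual datum with `X` f.g. torsion; the positivity says: every `Sel_{p^∞}(E/K_n)` and every `ker g_n` is finite — the rank-`0` tower in honest terms).
[cite: GreenbergLNM1716, §3 Lemma 3.1, §4 Lemma 4.3, Conj. 1.11] [cite: Washington1997, §13.3 Thm. 13.13] -/
theorem mu_eq_zero_iff_exists_natCard_selmerLayer_mul_kerG_lt_of_forall_pos (hγ : κ.IsTopGenerator γ) (D : W.SelmerDualData κ γ) [Module.Finite (IwasawaAlgebra p) D.X]
    (hD : D.IsTorsion) (hpos : ∀ n, 0 < Nat.card ↥(W.selmerLayer κ n) * Nat.card (W.KerG κ n))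
    (hh : ∃ T : ℕ, ∀ n, 0 < Nat.card (W.layerToInfty κ n).ker ∧ Nat.card (W.layerToInfty κ n).ker ≤ T) :
    D.mu = 0 ↔ ∃ n : ℕ, Nat.card ↥(W.selmerLayer κ n) * Nat.card (W.KerG κ n) < p ^ (p ^ n) := by
  -- positivity of the products gives positivity of the invariants, hence the rank-0 tower binders
  have hS : ∀ n, 0 < Nat.card ↥(W.selmerInfty κ ⊓ W.layerInvariants κ n) := fun n ↦ by
    have h43 := W.natCard_selmerInvariants_mul_natCard_ker_layerToInfty κ n
    have h := hpos n
    rw [← h43] at h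
    exact Nat.pos_of_mul_pos_right h
  obtain ⟨f, hf0, hchar⟩ := exists_charGenerator_ne_zero D.X hD
  have hpos' : ∀ n, 0 < Nat.card (D.X ⧸ (Ideal.span {((1 + PowerSeries.X : PowerSeries ℤ_[p]) ^ (p ^ n) - 1 : IwasawaAlgebra p)} • ⊤ : Submodule (IwasawaAlgebra p) D.X)) :=
    fun n ↦ by rw [natCard_layerQuotient_omega_eq_natCard_selmerInvariants W κ hγ D n]; exact hS n
  obtain ⟨h0, hΨ⟩ := (forall_natCard_quotient_omega_pos_iff (M := D.X) hD hchar).mp hpos'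
  rw [mu_eq_zero_iff_exists_natCard_selmerLayer_mul_kerG_lt W κ hγ D hD hchar h0 hΨ hh]
  exact ⟨fun ⟨n, _, hlt⟩ ↦ ⟨n, hlt⟩, fun ⟨n, hlt⟩ ↦ ⟨n, hpos n, hlt⟩⟩

end Selmer

/-! ## §3 `K = ℚ` -/

section Rat

variable (W : WeierstrassCurve ℚ) [W.IsElliptic] {p : ℕ} [hp : Fact p.Prime] (κ : ZpExtension ℚ p) {γ : Field.absoluteGaloisGroup ℚ}

/-- ★★★ **OVER `ℚ`: if every `#Sel_{p^∞}(E/ℚ_n)·#ker g_n(E/ℚ_n)` is positive (rank `0`, `Ш[p^∞]` and `ker g_n` finite at every layer) then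
`μ(X(E/ℚ_∞)) = 0 ⟺ ∃ n, #Sel_{p^∞}(E/ℚ_n)·#ker g_n(E/ℚ_n) < p^{pⁿ}`** — every elliptic `E/ℚ`, every prime `p`, every `ℤ_p`-extension with topological generator `γ`, every torsion dual datum;
no characteristic series, no `γ`-action, no reduction hypothesis in the statement. [cite: GreenbergLNM1716, §3 Lemma 3.1, §4 Lemma 4.3, Conj. 1.11] [cite: Washington1997, §13.3 Thm. 13.13] -/
theorem mu_eq_zero_iff_exists_natCard_selmerLayer_mul_kerG_lt_of_forall_pos_rat (hγ : κ.IsTopGenerator γ) (D : W.SelmerDualData κ γ) (hD : D.IsTorsion)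
    (hpos : ∀ n, 0 < Nat.card ↥(W.selmerLayer κ n) * Nat.card (W.KerG κ n)) :
    D.mu = 0 ↔ ∃ n : ℕ, Nat.card ↥(W.selmerLayer κ n) * Nat.card (W.KerG κ n) < p ^ (p ^ n) := by
  haveI : Module.Finite (IwasawaAlgebra p) D.X := D.module_finite_holds hγ
  exact mu_eq_zero_iff_exists_natCard_selmerLayer_mul_kerG_lt_of_forall_pos W κ hγ D hD hpos (exists_forall_natCard_ker_layerToInfty_pos_le W κ)

end Rat

end Summit.BirchSwinnertonDyer.BirchSwinnertonDyer.Theorems.AlignedTransportAtTwoHalfDescentBaseIndexRankZero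

end
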